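import Literature.NumberTheory.EllipticCurves.TorsionFrobeniusChebotarevProofs
import Literature.NumberTheory.EllipticCurves.ModPReducibilityProofs
import Literature.NumberTheory.EllipticCurves.DivisionValuesRootsOfUnity
import Literature.NumberTheory.EllipticCurves.LFunctionSmulProofs
import Literature.NumberTheory.EllipticCurves.OpenImageMazurAssemblyProofs
import Literature.NumberTheory.EllipticCurves.GlobalMinimalModelProofs
import Literature.NumberTheory.GaloisRepresentations.IntegralGaloisAction
import Literature.NumberTheory.GaloisRepresentations.FramedRepTwistEulerFactorProofs
import Summits.BirchSwinnertonDyer.Rank1Residual.ManinAdditive.NotTrivialEisensteinOfIrreducible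
import HarnessLib

/-!
# E-es-40₂ `NotTrivialEisensteinOfIrreducibleAtTwo` is a THEOREM: primes `r ≡ 1 (mod 2^M)` with `a_r(W)` odd when `W[2]`
# is irreducible (Chebotarev in `ℚ(W[2^{M+1}])`)

Summit `BirchSwinnertonDyer`, route `ManinLocalTwoThree` (cell bsd-f2-manin), deciding crux C2 `ManinOddAtFour`
(stmt-BirchSwinnertonDyer-22967), line `kato_shift_two` v7 (lead p1), **stub 4 `stub_notTrivialEisensteinAtTwo :
NotTrivialEisensteinOfIrreducibleAtTwo`** — es's candidate E-es-40₂ (MEMO-es §25.1), filed by -ty as a `@[conjecture]` leaf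
(p605991) because «Chebotarev is not in the tree».  It is: the tree PROVES Chebotarev's density theorem (existence form) for the
division fields `ℚ(E[n])` (`chebotarev_geomTorsion_holds`, via Heilbronn/Weber and the cyclotomic case), and this file turns
E-es-40₂ into a theorem:

* §1 `smul_ne_self_of_sq`, `pow_two_pow_smul_ne_self` — on an elementary abelian `2`-group a fixed-point-free automorphism has
  fixed-point-free square (`τ²a = a`, `b := τa` ⟹ `τ(a+b) = a+b ≠ 0`), hence so are all `τ^{2^j}` (no group orders needed);
* §2 `exists_geomTorsion_not_killed`, `exists_geomTorsion_exactOrder` — a point of exact order `2^{k+1}` in `E[2^{k+1}]`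
  (`#E[n] = n²`, `card_torsionPoints_eq_sq_holds`, and a `gcd` argument);
* §3 `frob_smul_eq_pow_of_pow_eq_one` — an arithmetic Frobenius over an odd prime `ℓ` raises `2`-power roots of unity in `\bar ℚ`
  to the `ℓ`-th power (Mathlib `AlgHom.IsArithFrobAt.apply_of_pow_eq_one` in `\bar ℤ`, as in the tree's
  `GaloisRep.cyclotomicCharacter_apply_of_isArithFrobAt`);
* §4 `exists_prime_modEq_one_reductionPointCount_odd` — for `W` globally minimal with `W[2]` irreducible, `S` finite, `M`:
  a good prime `ℓ ∉ S`, `ℓ ≠ 2`, `ℓ ≡ 1 (mod 2^{M+1})`, with `#W̃(𝔽_ℓ)` odd.  Irreducibility gives `τ ∈ Γ_ℚ` fixed-point-free on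
  `W[2]` (`not_irreducible_of_forall_exists_smul_eq`); `σ := τ^{2^{M+1}}` is fixed-point-free on `W[2]` (§1) and FIXES a primitive
  `2^{M+1}`-th root of unity `ζ ∈ ℚ(W[2^{M+1}])` (`exists_isPrimitiveRoot_fixed`, the Weil pairing: `τζ = ζ^a`, `a` odd, Euler
  `a^{2^M} ≡ 1`); Chebotarev gives `Frob_ℓ = σ` on `W[2^{M+1}]`, so `Frob_ℓ ζ = ζ`, i.e. `ζ^ℓ = ζ` (§3), i.e. `ℓ ≡ 1 (mod 2^{M+1})`;
  and `Frob_ℓ` is fixed-point-free on `W[2]`, so `2 ∤ #W̃(𝔽_ℓ)` by the reduction of torsion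
  (`exists_frobenius_smul_eq_of_dvd_reductionPointCount_holds`, Silverman VII.3.1);
* §5 **`notTrivialEisensteinOfIrreducibleAtTwo_holds : NotTrivialEisensteinOfIrreducibleAtTwo`** (reduction to a global minimal
  model: `hasGlobalMinimalModel_rat_holds`, `LFunction_smul`, `Mazur1978.hasIrreducibleModPGaloisRep_smul_iff`,
  `LFunction_apply_prime_eq_frobeniusTrace`, `dvd_frobeniusTrace_sub_iff`) and the registered stub
  **`Theorems.stub_notTrivialEisensteinAtTwo`** BY NAME.

Axioms `propext`, `Classical.choice`, `Quot.sound`; no new definitions.  Nothing about BSD or Manin's conjecture is proved here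
(one of six stubs of the line; the reducible residual Rb is open).  References: J. Tate, *Global class field theory* (Cassels–
Fröhlich 1967) §2.4; J.-P. Serre, Invent. Math. 15 (1972) §4; J. H. Silverman, *AEC* III.6.4, III.8.1.1, VII.3.1; cell memo
HOME/MEMO-es.md §25.1 (E-es-40₂).
-/

set_option autoImplicit false
set_option linter.dupNamespace false

noncomputable section

open scoped Classical

open NumberField IsDedekindDomain Field WeierstrassCurve
  Literature.NumberTheory.EllipticCurves Literature.NumberTheory.GaloisRepresentations
  Summit.BirchSwinnertonDyer.Rank1Residual.ManinAdditive

namespace Summit.BirchSwinnertonDyer.BirchSwinnertonDyer.Theorems.ManinLocalTwoThree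

/-! ### §1  Fixed-point-free automorphisms of `2`-torsion groups survive squaring -/

section TwoTorsion

variable {G A : Type*} [Group G] [AddCommGroup A] [DistribMulAction G A]

/-- **Squaring preserves fixed-point-freeness on an elementary abelian `2`-group**: if every `a` has `a + a = 0` and `τ` fixes
no non-zero element, then neither does `τ²` — for `τ²a = a` put `b := τa`; then `τ(a + b) = a + b` with `a + b ≠ 0`. [folklore] -/
theorem smul_ne_self_of_sq (h2 : ∀ a : A, a + a = 0) {τ : G} (hτ : ∀ a : A, a ≠ 0 → τ • a ≠ a)
    (a : A) (ha : a ≠ 0) : (τ * τ) • a ≠ a := by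
  intro h
  rw [mul_smul] at h
  have hb : τ • a ≠ a := hτ a ha
  have hsum : a + τ • a ≠ 0 := by
    intro h0
    apply hb
    have h1 : τ • a = -a := eq_neg_of_add_eq_zero_right h0
    have h2a : -a = a := by
      have := h2 a
      exact (neg_eq_of_add_eq_zero_right this).symm ▸ rfl
    rw [h1]
    exact neg_eq_of_add_eq_zero_left (h2 a)
  apply hτ (a + τ • a) hsum
  rw [smul_add, h, add_comm]

/-- Hence every `τ^(2^j)` is fixed-point-free on such a group if `τ` is. [folklore] -/
theorem pow_two_pow_smul_ne_self (h2 : ∀ a : A, a + a = 0) {τ : G} (hτ : ∀ a : A, a ≠ 0 → τ • a ≠ a)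
    (j : ℕ) : ∀ a : A, a ≠ 0 → (τ ^ (2 ^ j)) • a ≠ a := by
  induction j with
  | zero => simpa using hτ
  | succ j ih =>
    intro a ha
    rw [pow_succ, pow_mul, pow_two]
    exact smul_ne_self_of_sq h2 ih a ha

end TwoTorsion

/-! ### §2  A point of exact order `2^k` in `E[2^k]` (from `#E[n] = n²`) -/

section ExactOrder

/-- **`E[2^{k+1}]` contains a point not killed by `2^k`** (`#E[2^{k+1}] = 4^{k+1} > 4^k = #E[2^k]`, Silverman III.6.4(b)).
[cite: SilvermanAEC2009, Cor. III.6.4(b)] -/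
theorem exists_geomTorsion_not_killed (W : WeierstrassCurve ℚ) [W.IsElliptic] (k : ℕ) :
    ∃ T : W.geomPoints, ((2 ^ (k + 1) : ℕ) : ℤ) • T = 0 ∧ ((2 ^ k : ℕ) : ℤ) • T ≠ 0 := by
  by_contra h
  push Not at h
  -- then `E[2^{k+1}] ≤ E[2^k]`
  have hle : W.geomTorsion ((2 ^ (k + 1) : ℕ) : ℤ) ≤ W.geomTorsion ((2 ^ k : ℕ) : ℤ) := by
    intro T hT
    have hT' : ((2 ^ (k + 1) : ℕ) : ℤ) • T = 0 := by
      simpa only [AddSubgroup.torsionBy, Submodule.mem_toAddSubgroup, Submodule.mem_torsionBy_iff] using hT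
    have := h T hT'
    simpa only [AddSubgroup.torsionBy, Submodule.mem_toAddSubgroup, Submodule.mem_torsionBy_iff] using this
  have h1 : Nat.card (W.geomTorsion ((2 ^ (k + 1) : ℕ) : ℤ)) = (2 ^ (k + 1)) ^ 2 :=
    card_torsionPoints_eq_sq_holds W (AlgebraicClosure ℚ) (n := 2 ^ (k + 1))
      (by exact_mod_cast (pow_ne_zero (k + 1) two_ne_zero : (2 : ℕ) ^ (k + 1) ≠ 0))
  have h2 : Nat.card (W.geomTorsion ((2 ^ k : ℕ) : ℤ)) = (2 ^ k) ^ 2 :=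
    card_torsionPoints_eq_sq_holds W (AlgebraicClosure ℚ) (n := 2 ^ k)
      (by exact_mod_cast (pow_ne_zero k two_ne_zero : (2 : ℕ) ^ k ≠ 0))
  haveI : Finite (W.geomTorsion ((2 ^ k : ℕ) : ℤ)) := Nat.finite_of_card_ne_zero (by rw [h2]; positivity)
  have hcard := AddSubgroup.card_le_of_le hle
  rw [h1, h2] at hcard
  have : (2 ^ k) ^ 2 < (2 ^ (k + 1)) ^ 2 := by
    apply Nat.pow_lt_pow_left _ two_ne_zero
    exact Nat.pow_lt_pow_right (by norm_num) (Nat.lt_succ_self k)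
  omega

/-- **A point of exact order `2^{k+1}`** in the currency of `exists_isPrimitiveRoot_fixed`: `d • T ≠ 0` for `0 < d < 2^{k+1}` (a `d`
with `d • T = 0` would give `gcd(d, 2^{k+1}) • T = 0`, and that `gcd` divides `2^k`). [cite: SilvermanAEC2009, Cor. III.6.4(b)] -/
theorem exists_geomTorsion_exactOrder (W : WeierstrassCurve ℚ) [W.IsElliptic] (k : ℕ) :
    ∃ T : W.geomPoints, ((2 ^ (k + 1) : ℕ) : ℤ) • T = 0 ∧
      ∀ d : ℕ, 0 < d → d < 2 ^ (k + 1) → (d : ℤ) • T ≠ 0 := by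
  obtain ⟨T, hT, hT'⟩ := exists_geomTorsion_not_killed W k
  refine ⟨T, hT, fun d hd hdq hd0 ↦ hT' ?_⟩
  -- `g := gcd d 2^{k+1}` kills `T` and divides `2^k`
  set q : ℕ := 2 ^ (k + 1) with hq
  have hg : ((Nat.gcd d q : ℕ) : ℤ) • T = 0 := by
    have e : ((Nat.gcd d q : ℕ) : ℤ) = (d : ℤ) * Nat.gcdA d q + (q : ℤ) * Nat.gcdB d q := Nat.gcd_eq_gcd_ab d q
    rw [e, add_smul, mul_comm (d : ℤ), mul_smul, hd0, smul_zero, mul_comm (q : ℤ), mul_smul]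
    rw [hq] at hT ⊢
    rw [hT, smul_zero, add_zero]
  obtain ⟨j, hj, hgj⟩ := (Nat.dvd_prime_pow Nat.prime_two).mp (Nat.gcd_dvd_right d q)
  -- `j ≤ k` since `gcd ≤ d < 2^{k+1}`
  have hjk : j ≤ k := by
    by_contra hjk
    have hj' : j = k + 1 := by omega
    have hle : Nat.gcd d q ≤ d := Nat.le_of_dvd hd (Nat.gcd_dvd_left d q)
    rw [hgj, hj'] at hle
    omega
  obtain ⟨c, hc⟩ : 2 ^ j ∣ 2 ^ k := Nat.pow_dvd_pow 2 hjk
  rw [hc, Nat.cast_mul, mul_comm, mul_smul, ← hgj, hg, smul_zero]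

end ExactOrder

/-! ### §3  Frobenius on roots of unity: `Frob_ℓ ζ = ζ^ℓ` for `ζ ∈ μ_{2^k}`, `ℓ` odd -/

section FrobRoot

/-- **An arithmetic Frobenius at a prime of `\bar ℤ` over the odd prime `ℓ` raises `2`-power roots of unity to the `ℓ`-th power**
(Tate, GCFT §2.1/§3.4; Mathlib `AlgHom.IsArithFrobAt.apply_of_pow_eq_one` in `\bar ℤ`, as in the tree's
`GaloisRep.cyclotomicCharacter_apply_of_isArithFrobAt`). [cite: TateGCFT1967, §3.4 Proposition (PDF p. 208)] -/
theorem frob_smul_eq_pow_of_pow_eq_one {ℓ k : ℕ} (hℓ : ℓ.Prime) (hℓ2 : ℓ ≠ 2) {v : HeightOneSpectrum (𝓞 ℚ)}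
    (hv : (ℓ : 𝓞 ℚ) ∈ v.asIdeal) {𝔓 : Ideal (absIntegers (𝓞 ℚ) ℚ)} (h𝔓 : 𝔓 ∈ v.primesAbove)
    {φ : absoluteGaloisGroup ℚ} (hφ : IsArithFrobAt (𝓞 ℚ) φ 𝔓) {ζ : AlgebraicClosure ℚ} (hζ : ζ ^ 2 ^ k = 1) :
    φ • ζ = ζ ^ ℓ := by
  haveI : 𝔓.IsPrime := h𝔓.1
  have hvℓ : (Rat.HeightOneSpectrum.primesEquiv v : ℕ) = ℓ := primesEquiv_eq_of_natCast_mem hℓ hv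
  -- `2 ∉ v`
  have h2v : ((2 : ℕ) : 𝓞 ℚ) ∉ v.asIdeal := fun h ↦
    hℓ2 (hvℓ.symm.trans (primesEquiv_eq_of_natCast_mem Nat.prime_two h))
  -- `ζ` is an algebraic integer
  have hζi : IsIntegral (𝓞 ℚ) ζ :=
    IsIntegral.of_pow (pos_of_ne_zero (NeZero.ne (2 ^ k))) (by rw [hζ]; exact isIntegral_one)
  set x : absIntegers (𝓞 ℚ) ℚ := ⟨ζ, hζi⟩ with hx
  have hxN : x ^ 2 ^ k = 1 := Subtype.ext (by simp [hx, hζ])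
  have hm : ((2 ^ k : ℕ) : absIntegers (𝓞 ℚ) ℚ) ∉ 𝔓 := by
    intro h
    apply h2v
    rw [h𝔓.2.over, Ideal.mem_under, map_natCast]
    rw [Nat.cast_pow] at h
    exact Ideal.IsPrime.mem_of_pow_mem inferInstance k h
  have h := hφ.apply_of_pow_eq_one hxN hm
  rw [MulSemiringAction.toAlgHom_apply, HeightOneSpectrum.card_quotient_under_eq_residueCard h𝔓] at h
  have hres : v.residueCard = ℓ := by rw [FramedRep.residueCard_eq_coe_primesEquiv', hvℓ]
  have h' := congrArg (fun z : absIntegers (𝓞 ℚ) ℚ ↦ (z : AlgebraicClosure ℚ)) h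
  simpa [hx, integralClosure.coe_smul, hres] using h'

end FrobRoot

/-! ### §4  The Chebotarev argument for a globally minimal model -/

section Core

/-- **Primes `ℓ ≡ 1 (mod 2^{M+1})` of good reduction, off any finite set, with `#W̃(𝔽_ℓ)` odd, when `W[2]` is irreducible**
(`W` globally minimal).  Irreducibility gives `τ ∈ Γ_ℚ` fixed-point-free on `W[2]` (`not_irreducible_of_forall_exists_smul_eq`);
`σ := τ^{2^{M+1}}` is still fixed-point-free on `W[2]` (§1) and fixes a primitive `2^{M+1}`-th root of unity `ζ ∈ ℚ(W[2^{M+1}])`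
(`exists_isPrimitiveRoot_fixed`; `τζ = ζ^a`, `a` odd, Euler); Chebotarev (`chebotarev_geomTorsion_holds`) gives a good prime
`ℓ ∉ S ∪ {2}` whose Frobenius acts on `W[2^{M+1}]` as `σ`: it fixes `ζ`, so `ζ^ℓ = ζ` and `ℓ ≡ 1 (mod 2^{M+1})` (§3); it is
fixed-point-free on `W[2]`, so `2 ∤ #W̃(𝔽_ℓ)` by the reduction of torsion
(`exists_frobenius_smul_eq_of_dvd_reductionPointCount_holds`). [cite: TateGCFT1967, §2.4 (Tchebotarev density theorem)] -/
theorem exists_prime_modEq_one_reductionPointCount_odd (W : WeierstrassCurve ℚ) [W.IsElliptic] [W.IsGloballyMinimal]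
    (hirr : W.HasIrreducibleModPGaloisRep 2) (S : Finset ℕ) (M : ℕ) :
    ∃ (r : ℕ) (_ : Fact r.Prime), r ∉ S ∧ r ≠ 2 ∧ r ≡ 1 [MOD 2 ^ (M + 1)] ∧ W.HasGoodReductionAtPrime r ∧
      ¬ 2 ∣ W.reductionPointCount r := by
  classical
  haveI : Fact (Nat.Prime 2) := ⟨Nat.prime_two⟩
  haveI : NeZero (2 ^ (M + 1)) := ⟨pow_ne_zero _ two_ne_zero⟩
  have hq2 : 2 ≤ 2 ^ (M + 1) := by
    calc (2 : ℕ) = 2 ^ 1 := (pow_one 2).symm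
      _ ≤ 2 ^ (M + 1) := Nat.pow_le_pow_right (by norm_num) (by omega)
  have hqpos : 0 < 2 ^ (M + 1) := by positivity
  -- (1) an element fixed-point-free on `W[2]`
  obtain ⟨τ, hτ⟩ : ∃ τ : absoluteGaloisGroup ℚ, ∀ P : W.geomTorsion ((2 : ℕ) : ℤ), P ≠ 0 → τ • P ≠ P := by
    by_contra h
    push Not at h
    exact not_irreducible_of_forall_exists_smul_eq W 2 h hirr
  -- (2) `σ := τ ^ 2^{M+1}` is fixed-point-free on `W[2]`
  have h2 : ∀ P : W.geomTorsion ((2 : ℕ) : ℤ), P + P = 0 := by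
    intro P
    have hP : ((2 : ℕ) : ℤ) • (P : W.geomPoints) = 0 := by
      simpa only [AddSubgroup.torsionBy, Submodule.mem_toAddSubgroup, Submodule.mem_torsionBy_iff] using P.2
    apply Subtype.ext
    show (P : W.geomPoints) + P = 0
    rw [← two_zsmul]
    exact_mod_cast hP
  have hσ : ∀ P : W.geomTorsion ((2 : ℕ) : ℤ), P ≠ 0 → (τ ^ 2 ^ (M + 1)) • P ≠ P :=
    pow_two_pow_smul_ne_self h2 hτ (M + 1)
  -- (3) a primitive `2^{M+1}`-th root of unity fixed by the pointwise stabiliser of `W[2^{M+1}]`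
  obtain ⟨ζ, hζ, hζfix⟩ :=
    exists_isPrimitiveRoot_fixed (E := W) (q := 2 ^ (M + 1)) hq2 (exists_geomTorsion_exactOrder W M)
  -- (4) `σ` fixes `ζ`: `τ ζ = ζ^a` with `a` odd, and `a^{2^{M+1}} ≡ 1 (mod 2^{M+1})`
  have hτζq : (τ • ζ) ^ 2 ^ (M + 1) = 1 := by rw [← smul_pow', hζ.pow_eq_one, smul_one]
  obtain ⟨a, -, ha⟩ := hζ.eq_pow_of_pow_eq_one hτζq
  have hprim : IsPrimitiveRoot (τ • ζ) (2 ^ (M + 1)) :=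
    hζ.map_of_injective (f := (show AlgebraicClosure ℚ ≃ₐ[ℚ] AlgebraicClosure ℚ from τ))
      (show AlgebraicClosure ℚ ≃ₐ[ℚ] AlgebraicClosure ℚ from τ).injective
  rw [← ha] at hprim
  have hacop : a.Coprime (2 ^ (M + 1)) := (hζ.pow_iff_coprime hqpos a).mp hprim
  have ha0 : 0 < a := by
    rcases Nat.eq_zero_or_pos a with h0 | h0
    · rw [h0, Nat.coprime_zero_left] at hacop
      omega
    · exact h0
  have hpow : ∀ j : ℕ, (τ ^ j) • ζ = ζ ^ (a ^ j) := by
    intro j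
    induction j with
    | zero => rw [pow_zero, one_smul, pow_zero, pow_one]
    | succ j ih => rw [pow_succ, mul_smul, ← ha, smul_pow', ih, ← pow_mul, ← pow_succ]
  have hE : a ^ 2 ^ (M + 1) ≡ 1 [MOD 2 ^ (M + 1)] := by
    have h1 : a ^ Nat.totient (2 ^ (M + 1)) ≡ 1 [MOD 2 ^ (M + 1)] := Nat.ModEq.pow_totient hacop
    have htot : Nat.totient (2 ^ (M + 1)) = 2 ^ M := by
      rw [Nat.totient_prime_pow Nat.prime_two (by omega : 0 < M + 1), Nat.add_sub_cancel]
      omega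
    rw [htot] at h1
    have h2' := h1.pow 2
    rwa [← pow_mul, one_pow, ← pow_succ] at h2'
  have hσζ : (τ ^ 2 ^ (M + 1)) • ζ = ζ := by
    rw [hpow]
    have hd1 : 1 ≤ a ^ 2 ^ (M + 1) := Nat.one_le_pow _ _ ha0
    obtain ⟨c, hc⟩ := (Nat.modEq_iff_dvd' hd1).mp hE.symm
    have e : a ^ 2 ^ (M + 1) = 2 ^ (M + 1) * c + 1 := by omega
    rw [e, pow_succ, pow_mul, hζ.pow_eq_one, one_pow, one_mul]
  -- (5) Chebotarev off `S ∪ {2} ∪ {bad primes}`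
  have hΔ0 : minimalDiscriminantInt W ≠ 0 := minimalDiscriminantInt_ne_zero W
  let S' : Set ℕ := {ℓ | ℓ = 2 ∨ (ℓ : ℤ) ∣ minimalDiscriminantInt W ∨ ℓ ∈ S}
  have hS' : S'.Finite := by
    refine ((Set.finite_le_nat (max 2 (minimalDiscriminantInt W).natAbs)).union
      (S : Set ℕ).toFinite).subset ?_
    rintro ℓ (rfl | hℓ | hℓ)
    · exact Or.inl (Set.mem_setOf.mpr (le_max_left _ _))
    · exact Or.inl (Set.mem_setOf.mpr (le_max_of_le_right
        (Nat.le_of_dvd (Int.natAbs_pos.mpr hΔ0) (Int.natCast_dvd.mp hℓ))))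
    · exact Or.inr hℓ
  obtain ⟨ℓ, v, 𝔓, φ, hℓ, hℓS, hv, h𝔓, hφ, hagree⟩ :=
    chebotarev_geomTorsion_holds W ((2 ^ (M + 1) : ℕ) : ℤ) (by exact_mod_cast hqpos.ne') S' hS'
      (τ ^ 2 ^ (M + 1))
  haveI : Fact ℓ.Prime := ⟨hℓ⟩
  have hℓ2 : ℓ ≠ 2 := fun h ↦ hℓS (Or.inl h)
  have hℓΔ : ¬ (ℓ : ℤ) ∣ minimalDiscriminantInt W := fun h ↦ hℓS (Or.inr (Or.inl h))
  have hℓS₀ : ℓ ∉ S := fun h ↦ hℓS (Or.inr (Or.inr h))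
  have hgood : W.HasGoodReductionAtPrime ℓ := hasGoodReductionAtPrime_of_not_dvd W ℓ hℓΔ
  -- (6) the Frobenius fixes `ζ`
  have hψ : ∀ T : W.geomTorsion ((2 ^ (M + 1) : ℕ) : ℤ), ((τ ^ 2 ^ (M + 1))⁻¹ * φ) • T = T := by
    intro T
    rw [mul_smul, hagree T, inv_smul_smul]
  have hφζ : φ • ζ = ζ := by
    have h1 := hζfix _ hψ
    rw [mul_smul] at h1
    have h2' := congrArg (fun x ↦ (τ ^ 2 ^ (M + 1)) • x) h1
    simp only [smul_inv_smul] at h2'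
    rw [h2', hσζ]
  -- (7) `ℓ ≡ 1 (mod 2^{M+1})`
  have hfrob := frob_smul_eq_pow_of_pow_eq_one (k := M + 1) hℓ hℓ2 hv h𝔓 hφ hζ.pow_eq_one
  have hℓ1 : ℓ ≡ 1 [MOD 2 ^ (M + 1)] := by
    have hz : ζ ^ ℓ = ζ := by rw [← hfrob, hφζ]
    have hne : ζ ≠ 0 := hζ.ne_zero hqpos.ne'
    have h1 : ζ ^ (ℓ - 1) = 1 := by
      have : ζ ^ (ℓ - 1) * ζ = 1 * ζ := by
        rw [← pow_succ, Nat.sub_add_cancel hℓ.one_le, one_mul, hz]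
      exact mul_right_cancel₀ hne this
    have hdvd := (hζ.pow_eq_one_iff_dvd (ℓ - 1)).mp h1
    exact ((Nat.modEq_iff_dvd' hℓ.one_le).mpr hdvd).symm
  -- (8) `#W̃(𝔽_ℓ)` is odd: else the Frobenius fixes a non-zero point of `W[2]`
  refine ⟨ℓ, ⟨hℓ⟩, hℓS₀, hℓ2, hℓ1, hgood, fun hdvd2 ↦ ?_⟩
  obtain ⟨P, hP0, hP⟩ :=
    exists_frobenius_smul_eq_of_dvd_reductionPointCount_holds W 2 ℓ hℓ2 hgood hdvd2 v hv 𝔓 h𝔓 φ hφ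
  have hP2 : ((2 : ℕ) : ℤ) • (P : W.geomPoints) = 0 := by
    simpa only [AddSubgroup.torsionBy, Submodule.mem_toAddSubgroup, Submodule.mem_torsionBy_iff] using P.2
  have hPq : (P : W.geomPoints) ∈ W.geomTorsion ((2 ^ (M + 1) : ℕ) : ℤ) := by
    simp only [Submodule.mem_toAddSubgroup, Submodule.mem_torsionBy_iff]
    rw [Nat.cast_pow, pow_succ, mul_smul]
    show ((2 : ℕ) : ℤ) ^ M • (((2 : ℕ) : ℤ) • (P : W.geomPoints)) = 0
    rw [hP2, smul_zero]
  have hval : φ • (P : W.geomPoints) = (τ ^ 2 ^ (M + 1)) • (P : W.geomPoints) :=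
    congrArg Subtype.val (hagree ⟨P, hPq⟩)
  apply hσ P hP0
  apply Subtype.ext
  rw [AddSubgroup.torsionBy.coe_smul, ← hval, ← AddSubgroup.torsionBy.coe_smul, hP]

end Core

/-! ### §5  E-es-40₂ -/

/-- **E-es-40₂ `NotTrivialEisensteinOfIrreducibleAtTwo` (the `@[conjecture]` leaf of the cell, -ty p605991; stub 4
`stub_notTrivialEisensteinAtTwo` of line `kato_shift_two` v7) is a THEOREM**: for an elliptic `W/ℚ` with `W[2]` irreducible,
every finite `S` and every `M`, some prime `r ∉ S` with `r ≡ 1 (mod 2^M)` has `a_r(W) ≢ r + 1 (mod 2)` (indeed `a_r(W)` odd).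
Reduction to a global minimal model (`hasGlobalMinimalModel_rat_holds`, `LFunction_smul`, `hasIrreducibleModPGaloisRep_smul_iff`,
`LFunction_apply_prime_eq_frobeniusTrace`, `dvd_frobeniusTrace_sub_iff`) and `exists_prime_modEq_one_reductionPointCount_odd`.
[cite: TateGCFT1967, §2.4 (Tchebotarev density theorem)] -/
theorem notTrivialEisensteinOfIrreducibleAtTwo_holds : NotTrivialEisensteinOfIrreducibleAtTwo := by
  intro W _ hirr S M
  classical
  obtain ⟨C, hC⟩ := WeierstrassCurve.hasGlobalMinimalModel_rat_holds W
  haveI := hC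
  have hirr' : (C • W).HasIrreducibleModPGaloisRep 2 :=
    (Mazur1978.hasIrreducibleModPGaloisRep_smul_iff W C 2).mpr hirr
  obtain ⟨r, hr, hrS, _, hmod, hgood, hodd⟩ :=
    exists_prime_modEq_one_reductionPointCount_odd (C • W) hirr' S M
  refine ⟨r, hr.out, hrS, ?_, ?_⟩
  · rw [pow_succ'] at hmod
    exact Nat.ModEq.of_mul_left 2 hmod
  · rw [← WeierstrassCurve.LFunction_smul W C, WeierstrassCurve.LFunction_apply_prime_eq_frobeniusTrace (C • W) r hgood]
    intro heq
    apply hodd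
    have h2 : ((((r : ℤ) + 1 : ℤ)) : ZMod 2) = (((C • W).frobeniusTrace r : ℤ) : ZMod 2) := by
      rw [heq]; push_cast; ring
    have h3 := (ZMod.intCast_eq_intCast_iff_dvd_sub ((r : ℤ) + 1) ((C • W).frobeniusTrace r) 2).mp h2
    exact (dvd_frobeniusTrace_sub_iff (C • W) 2 r).mp (by exact_mod_cast h3)

end Summit.BirchSwinnertonDyer.BirchSwinnertonDyer.Theorems.ManinLocalTwoThree

namespace Summit.BirchSwinnertonDyer.BirchSwinnertonDyer.Theorems

/-- **Stub 4 of line `kato_shift_two` v7 (crux C2 `ManinOddAtFour`, stmt-BirchSwinnertonDyer-22967), registered signature verbatim: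
`stub_notTrivialEisensteinAtTwo : NotTrivialEisensteinOfIrreducibleAtTwo`** — PROVED
(`ManinLocalTwoThree.notTrivialEisensteinOfIrreducibleAtTwo_holds`). [cite: TateGCFT1967, §2.4 (Tchebotarev density theorem)] -/
theorem stub_notTrivialEisensteinAtTwo : NotTrivialEisensteinOfIrreducibleAtTwo :=
  ManinLocalTwoThree.notTrivialEisensteinOfIrreducibleAtTwo_holds

end Summit.BirchSwinnertonDyer.BirchSwinnertonDyer.Theorems

end
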